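import Summits.Ventures.DiscreteObjects.PP12.OrderElevenHomologyNormal

/-!
# PP(12), order-11 cell, Case A: the FORCED COLUMN of a normal homology array
Framing: lottery ticket; floor = certified bounds/negative ranges.

Cell pub-namedobj (venture DiscreteObjects), target (M), designs gen 22 (P11-SIZING.md). In a normal array (`Homology12.IsNormal`: row `0 = (·,0,1,…,10)`,
rows bijective onto `ZMod 11` off the hole, row differences off the holes non-zero and distinct) the column `0` is forced as well: **`a i 0 + 1 = i`**
(`IsNormal.col0`). Reason: row `i` sums to `Σ ZMod 11 = 0` off its hole; its differences with row `0` off `{0, i}` are the ten NON-ZERO residues, which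
also sum to `0`; and `Σ_{j ∉ {0,i}} a 0 j = −(i − 1)`. This removes ten of the eleven first-digit branches of the completeness walks of the Case A
certificate (designs g22 measurements: one branch ≈ 52k prefix nodes, above the kernel's per-declaration memory bound). No `sorry`, no new axioms.
-/

namespace Summit.Ventures.DiscreteObjects.PP12

namespace Homology12

open Finset

/-- the residues of `ZMod 11` sum to `0` -/
theorem sum_univ_zmod11 : ∑ x : ZMod 11, x = 0 := by decide

/-- the non-zero residues of `ZMod 11` sum to `0` -/
theorem sum_erase_zero_zmod11 : ∑ x ∈ (univ : Finset (ZMod 11)).erase 0, x = 0 := by decide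

/-- `Σ_{j ≠ 0} (j − 1) = 0` over the indices `Fin 12`, read in `ZMod 11` -/
theorem sum_row0 : ∑ j ∈ (univ : Finset (Fin 12)).erase 0, ((((j : ℕ) : ZMod 11)) - 1) = 0 := by decide

/-- a row of a normal array hits every residue off its hole: `Σ_{j ≠ i} a i j = 0` -/
theorem IsNormal.sum_row {a : Fin 12 → Fin 12 → ZMod 11} (ha : IsNormal a) (i : Fin 12) : ∑ j ∈ (univ : Finset (Fin 12)).erase i, a i j = 0 := by
  have hinj : Set.InjOn (fun j => a i j) ↑((univ : Finset (Fin 12)).erase i) := by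
    intro j hj j' hj' e
    simp only [coe_erase, coe_univ, Set.mem_sdiff, Set.mem_univ, Set.mem_singleton_iff, true_and] at hj hj'
    by_contra hne
    exact ha.latin i j j' hj hj' hne e
  have himg : ((univ : Finset (Fin 12)).erase i).image (fun j => a i j) = univ := by
    apply eq_univ_of_card
    rw [card_image_of_injOn hinj, card_erase_of_mem (mem_univ _), card_univ, Fintype.card_fin, ZMod.card]
  have e := sum_image (f := fun x : ZMod 11 => x) hinj
  rw [himg, sum_univ_zmod11] at e
  exact e.symm

/-- the differences of row `i ≠ 0` with row `0` off `{0, i}` are the non-zero residues: they sum to `0` -/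
theorem IsNormal.sum_diff {a : Fin 12 → Fin 12 → ZMod 11} (ha : IsNormal a) {i : Fin 12} (hi : i ≠ 0) :
    ∑ j ∈ ((univ : Finset (Fin 12)).erase i).erase 0, (a i j - a 0 j) = 0 := by
  set T := ((univ : Finset (Fin 12)).erase i).erase 0 with hT
  have memT : ∀ {j}, j ∈ T → j ≠ 0 ∧ j ≠ i := fun {j} hj => by
    simp only [hT, mem_erase, mem_univ, and_true] at hj; exact ⟨hj.1, hj.2⟩
  have hinj : Set.InjOn (fun j => a i j - a 0 j) ↑T := by
    intro j hj j' hj' e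
    obtain ⟨hj0, hji⟩ := memT (mem_coe.1 hj)
    obtain ⟨hj'0, hj'i⟩ := memT (mem_coe.1 hj')
    by_contra hne
    exact ha.diff_ne i 0 hi j j' hne hji hj0 hj'i hj'0 e
  have himg : T.image (fun j => a i j - a 0 j) = (univ : Finset (ZMod 11)).erase 0 := by
    apply eq_of_subset_of_card_le
    · intro x hx
      rw [mem_image] at hx
      obtain ⟨j, hj, rfl⟩ := hx
      obtain ⟨hj0, hji⟩ := memT hj
      rw [mem_erase]
      exact ⟨fun e => ha.ne_of_ne i 0 j hi hji hj0 (sub_eq_zero.1 e), mem_univ _⟩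
    · have h0i : (0 : Fin 12) ∈ (univ : Finset (Fin 12)).erase i := by rw [mem_erase]; exact ⟨fun e => hi e.symm, mem_univ _⟩
      have cT : T.card = 10 := by rw [hT, card_erase_of_mem h0i, card_erase_of_mem (mem_univ _), card_univ, Fintype.card_fin]
      have cU : ((univ : Finset (ZMod 11)).erase 0).card = 10 := by rw [card_erase_of_mem (mem_univ _), card_univ, ZMod.card]
      rw [card_image_of_injOn hinj, cT, cU]
  have e := sum_image (f := fun x : ZMod 11 => x) hinj
  rw [himg, sum_erase_zero_zmod11] at e
  exact e.symm

/-- **the forced column**: `a i 0 + 1 = i` for every row `i ≠ 0` of a normal array -/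
theorem IsNormal.col0 {a : Fin 12 → Fin 12 → ZMod 11} (ha : IsNormal a) {i : Fin 12} (hi : i ≠ 0) : a i 0 + 1 = ((i : ℕ) : ZMod 11) := by
  have h1 := ha.sum_row i
  have h0T : (0 : Fin 12) ∈ (univ : Finset (Fin 12)).erase i := by rw [mem_erase]; exact ⟨hi.symm, mem_univ _⟩
  rw [← add_sum_erase _ _ h0T] at h1
  set T := ((univ : Finset (Fin 12)).erase i).erase 0 with hT
  have h2 := ha.sum_diff hi
  rw [sum_sub_distrib, sub_eq_zero] at h2
  -- Σ_T a 0 j = Σ_{j ≠ 0} (j − 1) − (i − 1)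
  have h3 : ∑ j ∈ T, a 0 j = ∑ j ∈ T, ((((j : ℕ) : ZMod 11)) - 1) := by
    apply sum_congr rfl
    intro j hj
    have hj0 : j ≠ 0 := by simp only [hT, mem_erase, mem_univ, and_true] at hj; exact hj.1
    have := ha.row0 j hj0
    linear_combination this
  have hiT : i ∈ (univ : Finset (Fin 12)).erase 0 := by rw [mem_erase]; exact ⟨hi, mem_univ _⟩
  have h4 : ∑ j ∈ (univ : Finset (Fin 12)).erase 0, ((((j : ℕ) : ZMod 11)) - 1) =
      ((((i : ℕ) : ZMod 11)) - 1) + ∑ j ∈ T, ((((j : ℕ) : ZMod 11)) - 1) := by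
    rw [hT, erase_right_comm]
    exact (add_sum_erase _ (fun j : Fin 12 => (((j : ℕ) : ZMod 11)) - 1) hiT).symm
  rw [sum_row0] at h4
  rw [h2, h3] at h1
  linear_combination h1 + h4

end Homology12

end Summit.Ventures.DiscreteObjects.PP12
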